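import Summits.HodgeConjecture.HodgeConjecture.Theses.HeckePrymWeil
import Summits.HodgeConjecture.HodgeConjecture.Theses.AnchorTransport
import Summits.HodgeConjecture.HodgeConjecture.Theorems.HeckePrymWeilWeilTwelvefoldsSqrtMinus7IsotypicSchoenLines
import Summits.HodgeConjecture.HodgeConjecture.Theorems.HeckePrymWeilWeilTwelvefoldsSqrtMinus7IsotypicHeckePrymPlaneChevalleyWeil
import Summits.HodgeConjecture.HodgeConjecture.Theorems.HeckePrymWeilWeilTwelvefoldsSqrtMinus7IsotypicProductAnchor
import Summits.HodgeConjecture.HodgeConjecture.Theorems.HeckePrymWeilWeilTwelvefoldsSqrtMinus7IsotypicReach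
import Summits.HodgeConjecture.HodgeConjecture.Theorems.HeckePrymWeilWeilTwelvefoldsSqrtMinus7IsotypicDescent
import Literature.AlgebraicGeometry.HodgeTheory.InvariantClassesFromTotalSpaceHolds
import Literature.AlgebraicGeometry.HodgeTheory.WeilClassesCyclicPrymDegreeSeven
import Literature.AlgebraicGeometry.HodgeTheory.WeilFamilyReachSystem
import Literature.AlgebraicGeometry.HodgeTheory.HeckePrymF21WeilTwelvefold
import Literature.AlgebraicGeometry.Motives.Jacobian
import Literature.AlgebraicGeometry.Motives.PrymVariety
import Literature.AlgebraicGeometry.Motives.FamiliesVHS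
import HarnessLib

/-!
# `WeilTwelvefoldsSqrtMinus7` from Hecke–Prym-anchored transport and four named facts

Crux `WeilTwelvefoldsSqrtMinus7` (stmt-HodgeConjecture-1261) of route `HeckePrymWeil`, line
`isotypic-unimodular-saturation` (lead seat c2) — THE LINE'S DELIVERABLE after wave 1 / reshape r1:
the crux (every rational `(6,6)` Weil class on every `ℚ(√-7)`-Weil abelian 12-fold is algebraic)
follows from
* (T) TRANSPORT — the variational Hodge statement for Weil classes on smooth projective families of
  `ℚ(√-7)`-Weil 14-folds over a smooth irreducible base from ONE Hecke–Prym-product anchor fibre where the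
  class is algebraic (the line's open C⁺, registered stub `stub_transport`; it is
  `AnchorTransport.VariationalHodge` (stmt-HodgeConjecture-1076) restricted —
  `weilTwelvefolds_of_variationalHodge_and_facts`);
* (F1) `Schoen1988_cyclicPrym_weilClasses_algebraic_degreeSeven` — Schoen 1988 Cor. 3.1 = Patel–Zhang 2025
  Thm 1.2/5.3 at prime degree 7 (published theorem, Literature named fact);
* (F2) `Motives.two_mul_dim_eq_finrank_bettiCohomology` — `dim J(C) = g(C)` (Milne Prop. 2.1; named fact);
* (F3) `weilFamily_hyperbolic_weilSystem_reach` — the hyperbolic Weil family reaches every hyperbolic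
  `(A, φ)` up to `K`-isogeny, with a flat Weil local system (van Geemen §5, Deligne; named fact);
* (F4) `exists_heckePrymDatum_F21` — an étale `F₂₁`-cover of a genus-3 curve whose Hecke–Prym is a
  `ℚ(√-7)`-Weil `(6,6)` twelvefold exists (Riemann existence, Lange–Rodríguez 2022; named fact).
Everything else — Hecke–Prym Weil plane = restriction of Schoen's lines (Chevalley–Weil by traces,
`μ₃`-coinvariants, Gauss sum `φ'² = -7`), product anchor algebraic and isogeny-stable, CM partner surface
with descent pair, global classes from the total space (Deligne 1968, discharged), Schoen/Koike descent,
and all single-operator typing — is PROVED in the tree (`Theorems/HeckePrymWeilWeilTwelvefoldsSqrtMinus7Isotypic*`).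
-/

noncomputable section

set_option linter.dupNamespace false

open CategoryTheory
open Literature.AlgebraicGeometry Literature.AlgebraicGeometry.Motives
  Literature.AlgebraicGeometry.HodgeTheory Literature.AlgebraicTopology.SingularHomology

namespace Summit.HodgeConjecture.HodgeConjecture.Theorems.WeilTwelvefoldsSqrtMinus7.IsotypicUnimodularSaturation

/-- **Hecke–Prym-anchored transport (T) + the four named facts (F1)–(F4) ⟹ `WeilTwelvefoldsSqrtMinus7`.**
Given a 12-fold `(A, φ)` and a rational `(6,6)` Weil class `c`: if `c = 0` it is algebraic; otherwise
`stub_reach_of_facts` (Deligne's partie fixe discharged by `deligne1968_invariantClass_fromTotalSpace_holds`)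
gives the partner surface `B`, the family `f : 𝒳 ⟶ S` with `𝒳_{s₁} ≅ A × B`, the global class `𝒰` and the
anchor fibre `𝒳_{s₀} ≅ Y ~ P' × B'`; `stub_schoenLines_of_schoen1988` (F1) feeds
`stub_heckePrymWeilPlane_of_two_mul_dim_eq_finrank_bettiCohomology` (F2), which with `stub_productAnchor`
makes `𝒰|_{s₀}` algebraic on `Y`; (T) transports to `s₁`; `mem_algebraicClasses_map_of_iso` and
`stub_descent` return to `A`.
[cite: Schoen1988HodgeWeil, Cor. 3.1] [cite: PatelZhang2025PrymHodge, Thm 1.2] [cite: Schoen1998HodgeWeilAddendum, §10]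
[cite: vanGeemen1994HodgeAV, 3.6–3.7 and §5] [cite: Markman2025SurveySecant, §11.5] -/
theorem weilTwelvefolds_of_transport_and_facts
    (h₄ : ∀ ⦃𝒳 S : SchemeOver ℂ⦄ (f : 𝒳 ⟶ S), IsSmoothProjectiveFamily f 14 →
      IrreducibleSpace S.left → AlgebraicGeometry.Smooth S.hom →
    ∀ (A : complexBetti 𝒳 14),
      (∀ s : ComplexPoints S,
        IsRationalClass (complexBetti.map (fiberι f s) 14 A) ∧
        IsOfHodgeType 14 (fiberOver f s) 14 7 7 (complexBetti.map (fiberι f s) 14 A)) →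
      -- every fibre is a Weil-type abelian 14-fold on which `A` restricts into the typed Weil plane
      (∀ s : ComplexPoints S, ∃ (Ys : AbelianVariety ℂ) (ψs : Ys ⟶ Ys) (es : Ys.X ≅ fiberOver f s),
        Ys.dim = 14 ∧ ψs ≫ ψs = -((7 : ℤ) • 𝟙 Ys) ∧
        complexBetti.map es.hom 14 (complexBetti.map (fiberι f s) 14 A) ∈
          Module.End.eigenspace (complexBetti.map (𝟙 Ys + ψs).hom.hom.hom 14).hom
              ((1 + Complex.I * (Real.sqrt (7 : ℝ) : ℂ)) ^ 14) ⊔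
            Module.End.eigenspace (complexBetti.map (𝟙 Ys + ψs).hom.hom.hom 14).hom
              ((1 - Complex.I * (Real.sqrt (7 : ℝ) : ℂ)) ^ 14)) →
      -- ONE fibre is a Hecke–Prym-product anchor (up to isogeny) on which `A` is an ALGEBRAIC Weil class
      (∃ (s₀ : ComplexPoints S) (Y : AbelianVariety ℂ) (ψ : Y ⟶ Y) (e : Y.X ≅ fiberOver f s₀),
        Y.dim = 14 ∧ ψ ≫ ψ = -((7 : ℤ) • 𝟙 Y) ∧
        (∃ (C : SchemeOver ℂ) (𝒥 : Jacobian C) (σ τ : C ⟶ C) (s t eN : 𝒥.J ⟶ 𝒥.J)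
            (sB tB : AbelianVariety.kerComponent eN ⟶ AbelianVariety.kerComponent eN)
            (φ' : AbelianVariety.kerComponent (𝟙 (AbelianVariety.kerComponent eN) - tB) ⟶
              AbelianVariety.kerComponent (𝟙 (AbelianVariety.kerComponent eN) - tB))
            (B' : AbelianVariety ℂ) (φB' : B' ⟶ B')
            (fY : Y ⟶ (AbelianVariety.kerComponent (𝟙 (AbelianVariety.kerComponent eN) - tB)).prod B')
            (gY : (AbelianVariety.kerComponent (𝟙 (AbelianVariety.kerComponent eN) - tB)).prod B' ⟶ Y)
            (m : ℕ),
          IsSmoothProjective 1 C ∧ 𝒥.J.dim = 43 ∧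
          σ ≫ σ ≫ σ ≫ σ ≫ σ ≫ σ ≫ σ = 𝟙 C ∧ τ ≫ τ ≫ τ = 𝟙 C ∧ σ ≫ τ = τ ≫ σ ≫ σ ∧
          (∀ P : ComplexPoints C, P ≫ σ ≠ P ∧ P ≫ τ ≠ P) ∧
          s = 𝒥.pushforward 𝒥 σ ∧ t = 𝒥.pushforward 𝒥 τ ∧
          eN = 𝟙 𝒥.J + s + s ≫ s + s ≫ s ≫ s + s ≫ s ≫ s ≫ s + s ≫ s ≫ s ≫ s ≫ s +
            s ≫ s ≫ s ≫ s ≫ s ≫ s ∧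
          sB ≫ AbelianVariety.kerComponentι eN = AbelianVariety.kerComponentι eN ≫ s ∧
          tB ≫ AbelianVariety.kerComponentι eN = AbelianVariety.kerComponentι eN ≫ t ∧
          φ' ≫ AbelianVariety.kerComponentι (𝟙 (AbelianVariety.kerComponent eN) - tB) =
            AbelianVariety.kerComponentι (𝟙 (AbelianVariety.kerComponent eN) - tB) ≫
              (sB + sB ≫ sB + sB ≫ sB ≫ sB ≫ sB - sB ≫ sB ≫ sB - sB ≫ sB ≫ sB ≫ sB ≫ sB -
                sB ≫ sB ≫ sB ≫ sB ≫ sB ≫ sB) ∧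
          B'.dim = 2 ∧ φB' ≫ φB' = -((7 : ℤ) • 𝟙 B') ∧
          (∀ b : complexBetti B'.X 2,
            b ∈ Module.End.eigenspace (complexBetti.map (𝟙 B' + φB').hom.hom.hom 2).hom
                  ((1 + Complex.I * (Real.sqrt (7 : ℝ) : ℂ)) ^ 2) ⊔
                Module.End.eigenspace (complexBetti.map (𝟙 B' + φB').hom.hom.hom 2).hom
                  ((1 - Complex.I * (Real.sqrt (7 : ℝ) : ℂ)) ^ 2) →
            b ∈ algebraicClasses B'.X 1) ∧
          AlgebraicGeometry.Flat fY.hom.hom.hom.left ∧ 0 < m ∧ fY ≫ gY = m • 𝟙 Y ∧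
          gY ≫ ψ = AbelianVariety.prodLift
            (AbelianVariety.fst (AbelianVariety.kerComponent (𝟙 (AbelianVariety.kerComponent eN) - tB)) B' ≫ φ')
            (AbelianVariety.snd (AbelianVariety.kerComponent (𝟙 (AbelianVariety.kerComponent eN) - tB)) B' ≫ φB') ≫
            gY) ∧
        complexBetti.map e.hom 14 (complexBetti.map (fiberι f s₀) 14 A) ∈
          Module.End.eigenspace (complexBetti.map (𝟙 Y + ψ).hom.hom.hom 14).hom
              ((1 + Complex.I * (Real.sqrt (7 : ℝ) : ℂ)) ^ 14) ⊔
            Module.End.eigenspace (complexBetti.map (𝟙 Y + ψ).hom.hom.hom 14).hom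
              ((1 - Complex.I * (Real.sqrt (7 : ℝ) : ℂ)) ^ 14) ∧
        complexBetti.map e.hom 14 (complexBetti.map (fiberι f s₀) 14 A) ∈ algebraicClasses Y.X 7) →
    ∀ s : ComplexPoints S,
      complexBetti.map (fiberι f s) 14 A ∈ algebraicClasses (fiberOver f s) 7)
    (h₁ : Schoen1988_cyclicPrym_weilClasses_algebraic_degreeSeven)
    (h₂ : two_mul_dim_eq_finrank_bettiCohomology)
    (h₅ : weilFamily_hyperbolic_weilSystem_reach) (h₆ : exists_heckePrymDatum_F21) :
    Summit.HodgeConjecture.HodgeConjecture.Theses.HeckePrymWeil.WeilTwelvefoldsSqrtMinus7 := by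
  have H₁ := stub_schoenLines_of_schoen1988 h₁
  have H₂ := stub_heckePrymWeilPlane_of_two_mul_dim_eq_finrank_bettiCohomology h₂
  have H₃ := stub_productAnchor
  have H₅ := stub_reach_of_facts deligne1968_invariantClass_fromTotalSpace_holds h₅ h₆
  have H₆ := stub_descent
  intro A φ hA hφ c hrat hH hW
  by_cases hc : c = 0
  · rw [hc]
    exact Submodule.zero_mem _
  obtain ⟨B, φB, hB, hφB, hpair, 𝒳, S, f, hf, hirr, hsm, s₁, e₁, hext⟩ :=
    H₅ A φ hA hφ ⟨c, hc, hrat, hH, hW⟩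
  refine H₆ A φ B φB hA hB hφ hφB hpair ?_ c hrat hH hW
  intro u hu huH huW
  obtain ⟨𝒰, hu𝒰, hall, hweil, s₀, Y, ψ, e, hY, hψ, hdatum, hplane⟩ := hext u hu huH huW
  obtain ⟨C, 𝒥, σ, τ, s, t, eN, sB, tB, φ', B', φB', fY, gY, m, hC, hg, hσ7, hτ3, hrel, hfree,
    hs, ht, heN, hsB, htB, hφ', hB', hφB', hB'alg, hflat, hm, hfg, hgψ⟩ := hdatum
  -- Schoen's lines on `B_N` (Stub 1), the Hecke–Prym's Weil plane (Stub 2), the anchor (landed)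
  have hS := H₁ C 𝒥 σ hC hg hσ7 (fun P => (hfree P).1) s eN hs heN sB hsB
  obtain ⟨hPdim, hφ'sq, hPalg⟩ :=
    H₂ C 𝒥 σ τ hC hg hσ7 hτ3 hrel hfree s t eN hs ht heN sB tB hsB htB φ' hφ' hS
  have hYalg := H₃ _ φ' hPdim hφ'sq hPalg B' φB' hB' hφB' hB'alg Y ψ hY hψ fY gY m hflat hm hfg hgψ
  -- transport to the fibre over `s₁` (Stub 3 = C⁺)
  have h𝒰 : complexBetti.map (fiberι f s₁) 14 𝒰 ∈ algebraicClasses (fiberOver f s₁) 7 :=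
    h₄ f hf hirr hsm 𝒰 hall hweil
      ⟨s₀, Y, ψ, e, hY, hψ,
        ⟨C, 𝒥, σ, τ, s, t, eN, sB, tB, φ', B', φB', fY, gY, m, hC, hg, hσ7, hτ3, hrel, hfree,
          hs, ht, heN, hsB, htB, hφ', hB', hφB', hB'alg, hflat, hm, hfg, hgψ⟩,
        hplane, hYalg _ hplane⟩ s₁
  -- move along the isomorphism `e₁ : A × B ≅ 𝒳_{s₁}`
  have key := mem_algebraicClasses_map_of_iso (p := 7) (hf.isSmoothProjective s₁)
    (AbelianVariety.isSmoothProjective_holds (A := A.prod B)) e₁ h𝒰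
  rw [hu𝒰] at key
  exact key

/-- **`AnchorTransport.VariationalHodge` (stmt-HodgeConjecture-1076) + (F1)–(F4) ⟹ `WeilTwelvefoldsSqrtMinus7`**:
the variational Hodge conjecture in the tree's global-class form implies the Hecke–Prym-anchored transport
(T) (forget the anchor structure, keep "algebraic at `s₀`"; pull back along `e.symm` to return to the
fibre), hence, with the four named facts, the crux.
[cite: Markman2025SurveySecant, §11.5 and §12] -/
theorem weilTwelvefolds_of_variationalHodge_and_facts
    (hV : Summit.HodgeConjecture.HodgeConjecture.Theses.AnchorTransport.VariationalHodge)
    (h₁ : Schoen1988_cyclicPrym_weilClasses_algebraic_degreeSeven)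
    (h₂ : two_mul_dim_eq_finrank_bettiCohomology)
    (h₅ : weilFamily_hyperbolic_weilSystem_reach) (h₆ : exists_heckePrymDatum_F21) :
    Summit.HodgeConjecture.HodgeConjecture.Theses.HeckePrymWeil.WeilTwelvefoldsSqrtMinus7 := by
  refine weilTwelvefolds_of_transport_and_facts ?_ h₁ h₂ h₅ h₆
  intro 𝒳 S f hf hirr hsm A hall _ hanchor s
  obtain ⟨s₀, Y, ψ, e, -, -, -, -, halg⟩ := hanchor
  refine hV f hf hirr hsm 7 A hall ⟨s₀, ?_⟩ s
  have key := mem_algebraicClasses_map_of_iso (p := 7)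
    (AbelianVariety.isSmoothProjective_holds (A := Y)) (hf.isSmoothProjective s₀) e.symm halg
  have hid : complexBetti.map e.symm.hom 14 (complexBetti.map e.hom 14
      (complexBetti.map (fiberι f s₀) 14 A)) = complexBetti.map (fiberι f s₀) 14 A := by
    rw [← CategoryTheory.comp_apply, ← complexBetti.map_comp, Iso.symm_hom, Iso.inv_hom_id,
      complexBetti.map_id]
    rfl
  rw [hid] at key
  exact key

end Summit.HodgeConjecture.HodgeConjecture.Theorems.WeilTwelvefoldsSqrtMinus7.IsotypicUnimodularSaturation

end
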